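import Mathlib
import HarnessLib

/-!
# Route `ExtremiserTransience`, LINE g5-α (seat ns-idea-5): the Type-I bound survives the parabolic zoom with a
# constant independent of the zoom — Step 4 bookkeeping of S1 (`stub_plateauScalesFixed`, item 27822)

`--supports stmt-NavierStokesRegularity-27822`.  For a velocity field `u` on `(0,T) × ℝ³` with the eventual Type-I rate
`√(T−t)|u(t,y)| ≤ C√ν` on `[T₁,T)` and an early bound `|u(t,y)| ≤ N₀` on `(0,T₁)`, every zoom
`U(s,y) = A⁻¹ • u(τ + νs/A², x + (ν/A)•y)` with `0 < τ < T`, `A > 0`, satisfies on its whole past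
`s ∈ (−τA²/ν, 0)` the ancient Type-I bound `√(−s)|U(s,y)| ≤ max C (N₀√(T/ν))` (`zoom_typeI_bound`): late times give
`C√(−s)/√(g−s) ≤ C` with `g = (T−τ)A²/ν > 0`, early times give `√(−s)/A · N₀ ≤ √(T/ν)·N₀`.  This is the constant `K`
of S1's output (the same for every `n`), as consumed by S2 = `zoomCompactnessKNSS`.  Elementary real algebra; nothing about
Navier–Stokes is proved here, and no summit is proved by a line. [folklore]
-/

noncomputable section

open Set

namespace Summit.NavierStokesRegularity.NavierStokesRegularity.Theorems.ExtremiserTransience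

/-- **Type-I bound for zooms, uniformly in the zoom.** [folklore] -/
theorem zoom_typeI_bound {u : ℝ → EuclideanSpace ℝ (Fin 3) → EuclideanSpace ℝ (Fin 3)}
    {ν T T₁ C N₀ τ A : ℝ} (hν : 0 < ν) (hA : 0 < A) (hτT : τ < T) (hC : 0 ≤ C)
    (hlate : ∀ t : ℝ, T₁ ≤ t → t < T → ∀ y, Real.sqrt (T - t) * ‖u t y‖ ≤ C * Real.sqrt ν)
    (hearly : ∀ t : ℝ, 0 < t → t < T₁ → ∀ y, ‖u t y‖ ≤ N₀) (x : EuclideanSpace ℝ (Fin 3)) :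
    ∀ s : ℝ, -(τ * A ^ 2 / ν) < s → s < 0 → ∀ y : EuclideanSpace ℝ (Fin 3),
      Real.sqrt (-s) * ‖A⁻¹ • u (τ + ν * s / A ^ 2) (x + (ν / A) • y)‖ ≤
        max C (N₀ * Real.sqrt (T / ν)) := by
  intro s hs1 hs2 y
  have hA2 : 0 < A ^ 2 := pow_pos hA 2
  set t : ℝ := τ + ν * s / A ^ 2 with ht_def
  have ht0 : 0 < t := by
    have h1 : -(τ * A ^ 2) < ν * s := by
      have := mul_lt_mul_of_pos_left hs1 hν
      rw [mul_neg, mul_div_cancel₀ _ hν.ne'] at this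
      linarith
    have h2 : -τ < ν * s / A ^ 2 := by
      rw [lt_div_iff₀ hA2]; linarith
    simp only [ht_def]; linarith
  have htτ : t < τ := by
    have : ν * s / A ^ 2 < 0 := div_neg_of_neg_of_pos (mul_neg_of_pos_of_neg hν hs2) hA2
    simp only [ht_def]; linarith
  have htT : t < T := lt_trans htτ hτT
  rw [norm_smul, norm_inv, Real.norm_eq_abs, abs_of_pos hA]
  have hsqs : 0 ≤ Real.sqrt (-s) := Real.sqrt_nonneg _
  by_cases hcase : T₁ ≤ t
  · -- late time: `√(-s)/A · |u| ≤ C √(-s)/√(g - s) ≤ C`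
    have hrate := hlate t hcase htT (x + (ν / A) • y)
    have hTt : 0 < T - t := by linarith
    have hsqTt : 0 < Real.sqrt (T - t) := Real.sqrt_pos.2 hTt
    -- `T - t = (ν/A²)·(g - s)` with `g - s ≥ -s`, so `ν(-s) ≤ A²(T - t)`
    have hkey : ν * (-s) ≤ A ^ 2 * (T - t) := by
      have : A ^ 2 * (T - t) = A ^ 2 * (T - τ) + ν * (-s) := by
        simp only [ht_def]; field_simp; ring
      rw [this]; nlinarith [hA2, hτT]
    have hsq : Real.sqrt (-s) * Real.sqrt ν ≤ A * Real.sqrt (T - t) := by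
      rw [← Real.sqrt_mul (by linarith), ← Real.sqrt_sq hA.le, ← Real.sqrt_mul hA2.le]
      exact Real.sqrt_le_sqrt (by linarith)
    have hu : ‖u t (x + (ν / A) • y)‖ ≤ C * Real.sqrt ν / Real.sqrt (T - t) := by
      rw [le_div_iff₀ hsqTt, mul_comm]; exact hrate
    calc Real.sqrt (-s) * (A⁻¹ * ‖u t (x + (ν / A) • y)‖)
        ≤ Real.sqrt (-s) * (A⁻¹ * (C * Real.sqrt ν / Real.sqrt (T - t))) := by gcongr
      _ = C * (Real.sqrt (-s) * Real.sqrt ν) / (A * Real.sqrt (T - t)) := by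
          field_simp
      _ ≤ C * (A * Real.sqrt (T - t)) / (A * Real.sqrt (T - t)) := by gcongr
      _ = C := by field_simp
      _ ≤ max C (N₀ * Real.sqrt (T / ν)) := le_max_left _ _
  · -- early time: `√(-s)/A · N₀ ≤ √(T/ν) N₀`
    push Not at hcase
    have hu : ‖u t (x + (ν / A) • y)‖ ≤ N₀ := hearly t ht0 hcase _
    have hs_le : -s ≤ T * A ^ 2 / ν := by
      have : -(T * A ^ 2 / ν) ≤ -(τ * A ^ 2 / ν) := by
        apply neg_le_neg; gcongr
      linarith
    have hsq : Real.sqrt (-s) ≤ A * Real.sqrt (T / ν) := by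
      rw [← Real.sqrt_sq hA.le, ← Real.sqrt_mul hA2.le]
      exact Real.sqrt_le_sqrt (by rw [show A ^ 2 * (T / ν) = T * A ^ 2 / ν by ring]; exact hs_le)
    calc Real.sqrt (-s) * (A⁻¹ * ‖u t (x + (ν / A) • y)‖)
        ≤ (A * Real.sqrt (T / ν)) * (A⁻¹ * N₀) := by gcongr
      _ = N₀ * Real.sqrt (T / ν) := by field_simp
      _ ≤ max C (N₀ * Real.sqrt (T / ν)) := le_max_right _ _

end Summit.NavierStokesRegularity.NavierStokesRegularity.Theorems.ExtremiserTransience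

end
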